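import Mathlib
import Literature.MathematicalPhysics.QuantumFieldTheory.Balaban1983to89.B7Prop1Local
import Literature.MathematicalPhysics.QuantumFieldTheory.Balaban1985CMP102.Setting
import Summits.QuantumFields.Balaban3D.Proofs.TorusLift
import Summits.QuantumFields.Balaban3D.Proofs.Run3SmallFactors

/-!
# `Summit.QuantumFields.Balaban3D.Proofs.LiftBridge` — lane «pub-balaban3d» (Bałaban, CMP **102** (1985) 255–275, d = 3 lattice UV
# stability AS PRINTED), prover seat p2: THE LIFT of a torus gauge field to a periodic `U(N)`-valued configuration on `ηℤ³` through the
# group model (`…Balaban1985CMP102.Setting.GroupModel`: `G ⊂ U(N)` by `ρ`), and the identity of plaquette terms («bridge») between the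
# torus Wilson action (`Setup.wilsonAction`, `reTr`) and the 4D cell's `ηℤ³` holonomies (`B7Prop1Explicit.hol`, `plaqWord`)

HONEST FRAMING (lane PLAN.md §0).  Nothing of [B10] = [Balaban1985UV3] is asserted; carrier bookkeeping (LEAF-LEDGER §F4):
* `liftCfg 𝔊 U y κ := ρ(U(proj y, κ))` — `U(N)`-valued (`liftCfg_mem_unitaryUnits`);
* `val_hol_liftCfg` — `hol (liftCfg 𝔊 U) y (∂p) = ρ(U(∂p))` for the torus plaquette `p = (proj y; μ, ν)` (the orders of
  `Setup.GaugeField.plaqHol` and `B7Prop1Local.hol_plaqWord_eq` agree; `projSite_add_e`);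
* `bridge_liftCfg` — `η_k⁻¹[1 − Re tr U(∂p)] = L^k[1 − N⁻¹ Re Tr (lift U)(∂y)]` (`reTr = nReTr ∘ ρ`, `η_k = L^{−k}`): the hypothesis
  `hbridge` of `…Run3SmallFactors.lf_tower3_final` DISCHARGED for `Ul k h U := liftCfg 𝔊 (U_k(h, U))` — `lf_tower3_lift`.
-/

noncomputable section

namespace Summit.QuantumFields.Balaban3D.Proofs.LiftBridge

open Literature.MathematicalPhysics.QuantumFieldTheory.Balaban1983to89
open Literature.MathematicalPhysics.QuantumFieldTheory.Balaban1985CMP102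
open Literature.MathematicalPhysics.QuantumFieldTheory.Balaban1985CMP102.Setting
open Summit.QuantumFields.Balaban3D.Carriers
open Summit.QuantumFields.Balaban3D.Proofs.TorusLift (projSite projSite_add_e)
open Summit.QuantumFields.Balaban3D.Proofs.Run3SmallFactors (codeZ lf_tower3_final)
open B7Prop1Explicit (hol plaqWord)
open B7Prop1Local (pdevOn loK plaqHiK)
open B7Prop2Explicit (avgIter unitaryUnits)
open B10LargeField (xlog)
open Summit.QuantumFields.Balaban3D.Proofs.Thresholds (gamma71L)

variable {L : ℕ} {S : Scales L} {G : Type} [GaugeGroup G] [MeasurableSpace G]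

/-! ## §1 The lift and the plaquette identity -/

/-- **The lift** of a torus gauge field `U` on `T_η` to a (periodic) `U(N)`-valued bond configuration on `ηℤ^d` through the group
model: `(lift U)(y, κ) := ρ(U(proj y, κ))`. [cite: Balaban1985UV3, p.256] -/
def liftCfg (𝔊 : GroupModel G) (U : GaugeField S.P 0 G) :
    B7Prop1Explicit.Site S.P.d → Fin S.P.d → (Matrix (Fin 𝔊.N) (Fin 𝔊.N) ℂ)ˣ :=
  fun y κ => 𝔊.ρ.toHomUnits (U ⟨projSite y, κ⟩)

/-- The lift is `U(N)`-valued. [folklore] -/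
theorem liftCfg_mem_unitaryUnits (𝔊 : GroupModel G) (U : GaugeField S.P 0 G) (y : B7Prop1Explicit.Site S.P.d) (κ : Fin S.P.d) :
    liftCfg 𝔊 U y κ ∈ unitaryUnits (Matrix (Fin 𝔊.N) (Fin 𝔊.N) ℂ) := by
  rw [B7Prop2Explicit.mem_unitaryUnits]
  exact 𝔊.mem_unitary _

/-- **The plaquette holonomy of the lift is `ρ` of the torus plaquette variable:** `(lift U)(∂y) = ρ(U(∂p))`, `p = (proj y; μ, ν)`.
[cite: Balaban1985Averaging, (9) p.18] -/
theorem val_hol_liftCfg (𝔊 : GroupModel G) (U : GaugeField S.P 0 G) (y : B7Prop1Explicit.Site S.P.d) {μ ν : Fin S.P.d}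
    (hμν : μ < ν) :
    ((hol (liftCfg 𝔊 U) y (plaqWord μ ν) : (Matrix (Fin 𝔊.N) (Fin 𝔊.N) ℂ)ˣ) : Matrix (Fin 𝔊.N) (Fin 𝔊.N) ℂ) =
      𝔊.ρ (GaugeField.plaqHol U ⟨projSite y, μ, ν, hμν⟩) := by
  rw [B7Prop1Local.hol_plaqWord_eq]
  simp only [liftCfg, projSite_add_e, ← map_inv, ← map_mul, MonoidHom.coe_toHomUnits]
  rfl

/-- **THE BRIDGE:** the plaquette term of the scale-`k` torus Wilson action, `η_k⁻¹[1 − Re tr U(∂p)]` (`reTr` = the normalised trace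
of the model, `η_k = L^{−k}`), equals `L^k[1 − N⁻¹ Re Tr (lift U)(∂y)]` at `p = (proj y; μ, ν)`. [cite: Balaban1985UV3, (1) p.256, (67) p.273] -/
theorem bridge_liftCfg (𝔊 : GroupModel G) (k : ℕ) (U : GaugeField S.P 0 G) (y : B7Prop1Explicit.Site S.P.d) {μ ν : Fin S.P.d}
    (hμν : μ < ν) :
    (S.eta k)⁻¹ * (1 - reTr (GaugeField.plaqHol U ⟨projSite y, μ, ν, hμν⟩)) =
      (L : ℝ) ^ k * (1 - (𝔊.N : ℝ)⁻¹ *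
        (((hol (liftCfg 𝔊 U) y (plaqWord μ ν) : (Matrix (Fin 𝔊.N) (Fin 𝔊.N) ℂ)ˣ) :
          Matrix (Fin 𝔊.N) (Fin 𝔊.N) ℂ).trace.re)) := by
  rw [val_hol_liftCfg, 𝔊.reTr_eq]
  have heta : (S.eta k)⁻¹ = (L : ℝ) ^ k := by
    show (((S.P.L : ℝ)⁻¹) ^ k)⁻¹ = (L : ℝ) ^ k
    rw [inv_pow, inv_inv]; rfl
  rw [heta]
  unfold UnitaryModel.nReTr
  rw [Fintype.card_fin, div_eq_inv_mul]

/-! ## §2 The large-field leaf with the bridge discharged -/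

open scoped Matrix.Norms.L2Operator

variable [HaarData G]

/-- **`LeafSystem.lf` FOR THE TOWER, LIFT FORM:** `…Run3SmallFactors.lf_tower3_final` with `Ul k h U := liftCfg 𝔊 (U_k(h, U))` — the
bridge hypothesis DISCHARGED (`bridge_liftCfg`), `U(N)`-valuedness by `liftCfg_mem_unitaryUnits`.  Residual hypotheses: the (α) displays
(67), large field, (68) about the lifted minimizers and the fields `V_j` (`Vl`), the masses off admissible histories (`hW`), data constants
and coupling window (p3), `hsites`, and the provisos NOT IN PRINT. [cite: Balaban1985UV3, pp.273–274, (67)–(71) p.273] -/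
theorem lf_tower3_lift (𝔊 : GroupModel G) (C : B10Assembly.Consts) (hd : C.d = 6 / Real.log C.L) (hCL : C.L = (L : ℝ))
    (hL : 2 ≤ L) (D : TowerInput S G) {ρ' r₀ A gs ε C₁ : ℝ}
    (hsites : ∀ k, k ≤ S.K → S.sites k = (Fintype.card (Site S.P k) : ℝ))
    (hW : ∀ (k : ℕ) (h : Hist S.P k) (U : GaugeField S.P k G), ¬ Hist.Admissible D.M₁ D.Rcol k h → D.W.mass k h U = 0)
    (hε : 0 < ε) (hC₁ : 0 < C₁) (hb₀ : 0 < D.b₀) (hp₀ : 0 < D.p₀)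
    (hrun : ∀ j, S.gk j = B10.gRun C.g C.L ε j)
    (hγ : ∀ j, j < S.K → S.gk j ≤ gamma71L C₁ L D.b₀ D.p₀)
    (Vl : (k : ℕ) → Hist S.P k → GaugeField S.P k G → ℕ →
      B7Prop1Explicit.Site S.P.d → Fin S.P.d → (Matrix (Fin 𝔊.N) (Fin 𝔊.N) ℂ)ˣ)
    (h67 : ∀ k, k ≤ S.K → ∀ (h : Hist S.P k), Hist.Admissible D.M₁ D.Rcol k h → ∀ (U : GaugeField S.P k G),
      ∀ e ∈ Hist.disc h, hol (avgIter L (liftCfg 𝔊 (D.UkH k h U)) e.1) (codeZ e) (plaqWord e.2.2.1 e.2.2.2) =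
        hol (Vl k h U e.1) (codeZ e) (plaqWord e.2.2.1 e.2.2.2))
    (hLF : ∀ k, k ≤ S.K → ∀ (h : Hist S.P k), Hist.Admissible D.M₁ D.Rcol k h → ∀ (U : GaugeField S.P k G),
      ∀ e ∈ Hist.disc h, S.gk e.1 * B10.pFun D.b₀ D.p₀ (S.gk e.1) ≤
        ‖((hol (Vl k h U e.1) (codeZ e) (plaqWord e.2.2.1 e.2.2.2) : (Matrix (Fin 𝔊.N) (Fin 𝔊.N) ℂ)ˣ) :
          Matrix (Fin 𝔊.N) (Fin 𝔊.N) ℂ) - 1‖)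
    (h68 : ∀ k, k ≤ S.K → ∀ (h : Hist S.P k), Hist.Admissible D.M₁ D.Rcol k h → ∀ (U : GaugeField S.P k G),
      ∀ e ∈ Hist.disc h,
        pdevOn (loK L e.1 (codeZ e)) (plaqHiK L e.1 (codeZ e) e.2.2.1 e.2.2.2) (liftCfg 𝔊 (D.UkH k h U)) <
          C₁ * (S.gk e.1 * B10.pFun D.b₀ D.p₀ (S.gk e.1)) * (((L : ℝ) ^ e.1)⁻¹) ^ 2)
    (hM : 0 < D.M₁) (hRcol : ∀ i j, i ≤ j → j ≤ S.K → D.Rcol j ≤ D.Rcol i) (hρ : 0 ≤ ρ') (hr : 0 ≤ r₀)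
    (hRle : ∀ i, i ≤ S.K → (D.Rcol i : ℝ) ≤ ρ' * xlog (S.gk i) ^ r₀)
    (hz0 : ∀ j, j < S.K → 0 ≤ D.zcoef j) (hz : ∀ j, j < S.K → D.zcoef j ≤ A * xlog (S.gk j))
    (hA : 0 ≤ A)
    (hg : ∀ j, j ≤ S.K → 0 < S.gk j ∧ S.gk j ≤ gs) (hgs : gs ≤ 1)
    (hp : r₀ * 3 + 2 ≤ 2 * D.p₀)
    (hb₁ : 8 * (A * (2 * (2 * ρ' + 2 * ((L : ℝ) * (3 * ((D.M₁ : ℝ) - 1)) + 3 * ((L : ℝ) - 1)) + 20) * 1) ^ 3 /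
      (Real.log C.L / 2)) ≤ 1 / (4 * (𝔊.N : ℝ)) * D.b₀ ^ 2)
    (hb₂ : 56 ≤ 1 / (4 * (𝔊.N : ℝ)) * D.b₀ ^ 2) :
    ∀ k, k ≤ D.tower3.toTowerRun.K → ∀ U : D.tower3.toTowerRun.Cfg k,
      D.tower3.toTowerRun.LF k U (fun h => -(D.tower3.toTowerRun.mainT k h U) + D.tower3.toTowerRun.Zterm k h) ≤
        Real.exp (C.d * D.tower3.toTowerRun.sites k) := by
  haveI : NeZero 𝔊.N := ⟨Nat.pos_iff_ne_zero.mp 𝔊.N_pos⟩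
  exact lf_tower3_final C hd hCL hL D hsites hW hε hC₁ hb₀ hp₀ hrun hγ (fun k h U => liftCfg 𝔊 (D.UkH k h U)) Vl
    (fun k h U x κ => liftCfg_mem_unitaryUnits 𝔊 _ x κ) (fun k h U y μ ν hμν => bridge_liftCfg 𝔊 k (D.UkH k h U) y hμν)
    h67 hLF h68 hM hRcol hρ hr hRle hz0 hz hA hg hgs hp hb₁ hb₂

/-! ## §3 (67) read on the lift: `V_j := Ū_k^j`, the fields `V_j` eliminated from the hypotheses -/

/-- **`LeafSystem.lf` FOR THE TOWER, (67) DEFINITIONAL** (INSTANTIATION UPDATE 5, lead ruling R-B25′): in `lf_tower3_lift` take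
`Vl k h U j := avgIter L (liftCfg 𝔊 (U_k(h,U))) j` — print's `Ū_k^j`, the `j`-fold average (43) of [4] of the lifted composite
minimizer.  Then the hypothesis `h67` («`Ū_k^j(∂p′) = V_j(∂p′)`») holds by `rfl`, and the large-field condition of the history
«`|V_j(∂p′) − 1| ≥ g_jp(g_j)`, `p′ ∈ P_j`» (p. 273 L13) composed with (67) p. 273 L14 «`Ū_k^j = V_j` on `Λ_j`» (the constraint of (42)
p. 266 on the minimizer `U_k(V, {V_j})` of [7] Thm 1) is the ONE residual display `hLF67`: «`g_jp(g_j) ≤ |Ū_k^j(∂p′) − 1|` for every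
recorded large-field plaquette `(j, p′) ∈ P(h)` of an admissible history» — a property of the expansion datum `U_k(h,·)` alone (no
field `V_j` is data at the end theorem).  All other hypotheses as in `lf_tower3_lift`. [cite: Balaban1985UV3, (67)–(68) p.273, pp.273–274] -/
theorem lf_tower3_avg (𝔊 : GroupModel G) (C : B10Assembly.Consts) (hd : C.d = 6 / Real.log C.L) (hCL : C.L = (L : ℝ))
    (hL : 2 ≤ L) (D : TowerInput S G) {ρ' r₀ A gs ε C₁ : ℝ}
    (hsites : ∀ k, k ≤ S.K → S.sites k = (Fintype.card (Site S.P k) : ℝ))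
    (hW : ∀ (k : ℕ) (h : Hist S.P k) (U : GaugeField S.P k G), ¬ Hist.Admissible D.M₁ D.Rcol k h → D.W.mass k h U = 0)
    (hε : 0 < ε) (hC₁ : 0 < C₁) (hb₀ : 0 < D.b₀) (hp₀ : 0 < D.p₀)
    (hrun : ∀ j, S.gk j = B10.gRun C.g C.L ε j)
    (hγ : ∀ j, j < S.K → S.gk j ≤ gamma71L C₁ L D.b₀ D.p₀)
    (hLF67 : ∀ k, k ≤ S.K → ∀ (h : Hist S.P k), Hist.Admissible D.M₁ D.Rcol k h → ∀ (U : GaugeField S.P k G),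
      ∀ e ∈ Hist.disc h, S.gk e.1 * B10.pFun D.b₀ D.p₀ (S.gk e.1) ≤
        ‖((hol (avgIter L (liftCfg 𝔊 (D.UkH k h U)) e.1) (codeZ e) (plaqWord e.2.2.1 e.2.2.2) :
            (Matrix (Fin 𝔊.N) (Fin 𝔊.N) ℂ)ˣ) : Matrix (Fin 𝔊.N) (Fin 𝔊.N) ℂ) - 1‖)
    (h68 : ∀ k, k ≤ S.K → ∀ (h : Hist S.P k), Hist.Admissible D.M₁ D.Rcol k h → ∀ (U : GaugeField S.P k G),
      ∀ e ∈ Hist.disc h,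
        pdevOn (loK L e.1 (codeZ e)) (plaqHiK L e.1 (codeZ e) e.2.2.1 e.2.2.2) (liftCfg 𝔊 (D.UkH k h U)) <
          C₁ * (S.gk e.1 * B10.pFun D.b₀ D.p₀ (S.gk e.1)) * (((L : ℝ) ^ e.1)⁻¹) ^ 2)
    (hM : 0 < D.M₁) (hRcol : ∀ i j, i ≤ j → j ≤ S.K → D.Rcol j ≤ D.Rcol i) (hρ : 0 ≤ ρ') (hr : 0 ≤ r₀)
    (hRle : ∀ i, i ≤ S.K → (D.Rcol i : ℝ) ≤ ρ' * xlog (S.gk i) ^ r₀)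
    (hz0 : ∀ j, j < S.K → 0 ≤ D.zcoef j) (hz : ∀ j, j < S.K → D.zcoef j ≤ A * xlog (S.gk j))
    (hA : 0 ≤ A)
    (hg : ∀ j, j ≤ S.K → 0 < S.gk j ∧ S.gk j ≤ gs) (hgs : gs ≤ 1)
    (hp : r₀ * 3 + 2 ≤ 2 * D.p₀)
    (hb₁ : 8 * (A * (2 * (2 * ρ' + 2 * ((L : ℝ) * (3 * ((D.M₁ : ℝ) - 1)) + 3 * ((L : ℝ) - 1)) + 20) * 1) ^ 3 /
      (Real.log C.L / 2)) ≤ 1 / (4 * (𝔊.N : ℝ)) * D.b₀ ^ 2)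
    (hb₂ : 56 ≤ 1 / (4 * (𝔊.N : ℝ)) * D.b₀ ^ 2) :
    ∀ k, k ≤ D.tower3.toTowerRun.K → ∀ U : D.tower3.toTowerRun.Cfg k,
      D.tower3.toTowerRun.LF k U (fun h => -(D.tower3.toTowerRun.mainT k h U) + D.tower3.toTowerRun.Zterm k h) ≤
        Real.exp (C.d * D.tower3.toTowerRun.sites k) :=
  lf_tower3_lift 𝔊 C hd hCL hL D hsites hW hε hC₁ hb₀ hp₀ hrun hγ (fun k h U j => avgIter L (liftCfg 𝔊 (D.UkH k h U)) j)
    (fun _ _ _ _ _ _ _ => rfl) hLF67 h68 hM hRcol hρ hr hRle hz0 hz hA hg hgs hp hb₁ hb₂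

end Summit.QuantumFields.Balaban3D.Proofs.LiftBridge

end
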